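import Mathlib

/-!
# STUB-IDEAS k1 (gen 33) — «LOWER'S DIGIT AT `v` IS A LAYER-0 THEOREM» (weakest sufficient form)

Crux `stmt-BirchSwinnertonDyer-27851` = `PrintCf2.SplitBadTwoLowerHalfOfFacts`, stub of record
`stub_heegnerIndexLowerAtTwo` (active skeleton v3 `heegner_index_two`, sha16 `f2bd84c029a8a938`).
Technique (payload): «weaken / strengthen — find the weakest sufficient form and the strongest
provable form».  BSD is NOT proved by any of this; neither the crux nor the stub's LOWER inequality
is proved here.  Everything below is sorry-free abstract algebra (`import Mathlib` only).

WHAT ROW 85's ONE-SIDED BUDGET CONSUMES of the `(2)₂`-digit at `v` is `v₂(ev_key r_u) ≤ 1`, where the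
frame functional of record is `L = w • log₂/√u = (2w) • g`, `g = log₂/(2√u)` (R206), and `r_u` is the
scalar of `L` against a dual generator.  We type the GAUGE-FREE and CHARACTER-FREE form

  `LowerDigit L  :=  ∀ h r, L = r • h → r ∣ 2`

("every scalar through which `L` factors divides 2"; it implies `φ r ∣ 2` at EVERY character `φ` and
for EVERY presentation `h`, `LowerDigit.map_dvd_two`), and prove it from LAYER-0 data only:

* conductor 8 (`u ∈ {±2, ±6}`): ONE element of the receptacle with UNIT `g`-value
  (`lowerDigit_of_isUnit_apply`; read at layer 0 through a local hom `ε`, `layerZero_condEight`);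
* conductor 4 (`u ∈ {−1, 3}`): NON-FREENESS in dual form `∀ φ m, ¬ IsUnit (φ m)` + ONE element whose
  layer-0 `g`-value is `2·unit` (`lowerDigit_of_nonfree`), and NON-FREENESS itself from layer 0:
  rank one + the lower sandwich half `D₀ ⊆ Im(M → S₀)` + the census element `−1 ∈ D₀` (order 2) +
  one torsion-free image element (`not_isUnit_apply_of_image`) — NO `K3_EXACT`, NO torsion COUNT,
  NO module class, NO cyclic dual, NO injectivity of `g` ((S-T)), NO level map beyond `n = 0` ((S-Y)),
  NO layer-1 frame `ℚ₂(ζ₁₂)` (`layerZero_condFour`).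

Instantiation facts for the carriers of record (B55: `Λ_v = ℤ₂⟦T⟧ = IwasawaAlgebra 2`, `ε = ev₀` =
constant coefficient): `isLocalHom_constantCoeff`, `prime_C_of_span_isPrime` ⟹ `prime_two_powerSeries`,
`Irreducible (2 : ℤ_[2])`.  Consistency: K35's counter-model (`M` free, `L = 2(T+2)•id`) violates
`LowerDigit` (`counterModel_not_lowerDigit`) and violates non-freeness (the identity functional hits 1);
B53's layer-0-indistinguishable classes `𝔪 = (2,T)`, `𝔟' = (2,T²)`, `(2,T^k)`, and the free class all
carry the SAME LOWER digit for `L = 2w • incl` (`lowerDigit_smul_subtype`): LOWER is blind exactly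
where layer 0 is blind, so no exact-class input is ever consumed by LOWER.  PLAN B (receptacle, B46):
`LowerDigit` transports along any comparison map through which functionals extend uniquely
(`LowerDigit.comp_of_extend`); the index-2 SUBmodule keeps the digit (`lowerDigit_smul_subtype`),
the «multiplication by 2» comparison (invariants-type χ-part → coinvariants-type χ-part when `2 ∣ #Δ`)
LOSES it (`digit_lost_along_mul_two`) — the typed dichotomy behind B46 for LOWER.
-/

namespace Summit.BirchSwinnertonDyer.BirchSwinnertonDyer.Cruxes.SplitBadTwoLowerHalfOfFacts.LayerZeroLowerK1G33

open PowerSeries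

section Abstract

variable {Λ : Type*} [CommRing Λ] {M : Type*} [AddCommGroup M] [Module Λ M]

/-- The gauge-free, character-free form of the LOWER digit consumed by row 85's one-sided budget:
every scalar `r` through which the frame functional `L` factors (`L = r • h`) divides `2`. -/
def LowerDigit (L : M →ₗ[Λ] Λ) : Prop :=
  ∀ (h : M →ₗ[Λ] Λ) (r : Λ), L = r • h → r ∣ (2 : Λ)

/-- `LowerDigit` gives `φ r ∣ 2` at EVERY character `φ : Λ →+* O` (in particular `v(ev_key r_u) ≤ v(2)`
for the presentation of record). -/
theorem LowerDigit.map_dvd_two {L : M →ₗ[Λ] Λ} (hL : LowerDigit L) {h : M →ₗ[Λ] Λ} {r : Λ}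
    (hr : L = r • h) {O : Type*} [CommRing O] (φ : Λ →+* O) : φ r ∣ (2 : O) := by
  obtain ⟨c, hc⟩ := hL h r hr
  exact ⟨φ c, by rw [← map_mul, ← hc, map_ofNat]⟩

/-- CONDUCTOR 8 SHAPE.  If `L = (2w) • g` and `g` takes a UNIT value on one element, then every scalar
through which `L` factors divides `2`.  No domain, no class, no dual, no injectivity. -/
theorem lowerDigit_of_isUnit_apply (g L : M →ₗ[Λ] Λ) (w : Λˣ) (hL : L = ((2 : Λ) * w) • g)
    (m₀ : M) (hu : IsUnit (g m₀)) : LowerDigit L := by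
  intro h r hr
  obtain ⟨v, hv⟩ := hu
  have key : r * h m₀ = 2 * w * g m₀ := by
    have := congrArg (fun F : M →ₗ[Λ] Λ => F m₀) (hr.symm.trans hL)
    simpa [LinearMap.smul_apply, smul_eq_mul] using this
  refine ⟨h m₀ * ((v⁻¹ : Λˣ) : Λ) * ((w⁻¹ : Λˣ) : Λ), ?_⟩
  calc (2 : Λ) = 2 * w * g m₀ * ((v⁻¹ : Λˣ) : Λ) * ((w⁻¹ : Λˣ) : Λ) := by
        rw [← hv, mul_assoc (2 * (w : Λ)), Units.mul_inv, mul_one, mul_assoc, Units.mul_inv, mul_one]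
    _ = r * (h m₀ * ((v⁻¹ : Λˣ) : Λ) * ((w⁻¹ : Λˣ) : Λ)) := by rw [← key]; ring

/-- Layer-0 reading of the conductor-8 witness: a unit value AFTER a local hom `ε` (e.g. `ev₀`, the
constant coefficient `Λ_v → ℤ₂`) is a unit value. -/
theorem isUnit_apply_of_isUnit_map {O : Type*} [CommRing O] (ε : Λ →+* O) [IsLocalHom ε]
    (g : M →ₗ[Λ] Λ) (m₀ : M) (hu : IsUnit (ε (g m₀))) : IsUnit (g m₀) :=
  IsLocalHom.map_nonunit _ hu

/-- Division of a functional by a prime scalar that divides all its values (used once, in the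
conductor-4 dichotomy). -/
theorem exists_eq_smul_of_forall_dvd [IsDomain Λ] {p : Λ} (hp0 : p ≠ 0) (h : M →ₗ[Λ] Λ)
    (hdvd : ∀ x, p ∣ h x) : ∃ φ : M →ₗ[Λ] Λ, h = p • φ := by
  classical
  choose c hc using hdvd
  refine ⟨{ toFun := c, map_add' := ?_, map_smul' := ?_ }, ?_⟩
  · intro x y
    apply mul_left_cancel₀ hp0
    rw [← hc, map_add, hc x, hc y, mul_add]
  · intro a x
    apply mul_left_cancel₀ hp0
    rw [← hc, map_smul, smul_eq_mul, hc x, RingHom.id_apply, smul_eq_mul]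
    ring
  · ext x
    simp [LinearMap.smul_apply, smul_eq_mul, hc x]

/-- CONDUCTOR 4 SHAPE.  `Λ` a domain in which `2` is prime, `ε : Λ →+* O` a local hom into a ring in
which `2` is irreducible (`O = ℤ₂`), `L = (2w) • g`.  NON-FREENESS in dual form (no functional hits a
unit) + ONE element whose layer-0 `g`-value is `2·unit` ⟹ every scalar through which `L` factors
divides `2`.  No class (`𝔪` vs `(2,T²)` irrelevant), no cyclic dual, no injectivity of `g`. -/
theorem lowerDigit_of_nonfree [IsDomain Λ] (h2 : Prime (2 : Λ)) {O : Type*} [CommRing O]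
    (hirr : Irreducible (2 : O)) (ε : Λ →+* O) [IsLocalHom ε] (g L : M →ₗ[Λ] Λ) (w : Λˣ)
    (hL : L = ((2 : Λ) * w) • g) (NF : ∀ (φ : M →ₗ[Λ] Λ) (m : M), ¬ IsUnit (φ m)) (m₀ : M)
    (u₀ : Oˣ) (hwit : ε (g m₀) = 2 * u₀) : LowerDigit L := by
  intro h r hr
  have hirr' : Irreducible ((2 : O) * u₀) := (irreducible_mul_isUnit u₀.isUnit).mpr hirr
  -- pointwise identity `r * h x = 2 * w * g x`
  have key : ∀ x, r * h x = 2 * w * g x := fun x => by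
    have := congrArg (fun F : M →ₗ[Λ] Λ => F x) (hr.symm.trans hL)
    simpa [LinearMap.smul_apply, smul_eq_mul] using this
  -- `ε` of a non-unit is a non-unit (contrapositive of `IsLocalHom`)
  have εnu : ∀ a : Λ, ¬ IsUnit a → ¬ IsUnit (ε a) := fun a ha hεa => ha (IsLocalHom.map_nonunit a hεa)
  by_cases hr2 : (2 : Λ) ∣ r
  · -- case `2 ∣ r`: `r = 2 r'`, `g = (w⁻¹ r') • h`, the witness forces `r'` to be a unit
    obtain ⟨r', rfl⟩ := hr2
    have hg : ∀ x, g x = ((w⁻¹ : Λˣ) : Λ) * r' * h x := fun x => by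
      have hx := key x
      have : (2 : Λ) * (r' * h x) = 2 * (w * g x) := by rw [← mul_assoc, hx]; ring
      have h' := mul_left_cancel₀ h2.ne_zero this
      calc g x = ((w⁻¹ : Λˣ) : Λ) * (w * g x) := by rw [← mul_assoc, Units.inv_mul, one_mul]
        _ = _ := by rw [← h']; ring
    have hprod : ε (((w⁻¹ : Λˣ) : Λ) * r') * ε (h m₀) = 2 * u₀ := by
      rw [← map_mul, ← hwit, hg m₀, mul_assoc]
    have hu : IsUnit (ε (((w⁻¹ : Λˣ) : Λ) * r')) := by
      rcases hirr'.isUnit_or_isUnit hprod.symm with h1 | h1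
      · exact h1
      · exact absurd h1 (εnu _ (NF h m₀))
    have hr'u : IsUnit r' := by
      have := IsLocalHom.map_nonunit _ hu
      exact isUnit_of_mul_isUnit_right this
    obtain ⟨v, hv⟩ := hr'u
    exact ⟨((v⁻¹ : Λˣ) : Λ), by rw [← hv, mul_assoc, Units.mul_inv, mul_one]⟩
  · -- case `2 ∤ r`: then `2 ∣ h x` for all `x`, `h = 2 • φ`, and `φ m₀` would be a unit unless `r` is
    have hdvd : ∀ x, (2 : Λ) ∣ h x := fun x => by
      have : (2 : Λ) ∣ r * h x := ⟨w * g x, by rw [key x]; ring⟩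
      rcases h2.dvd_or_dvd this with h1 | h1
      · exact absurd h1 hr2
      · exact h1
    obtain ⟨φ, hφ⟩ := exists_eq_smul_of_forall_dvd h2.ne_zero h hdvd
    have hg : ∀ x, g x = ((w⁻¹ : Λˣ) : Λ) * r * φ x := fun x => by
      have hx := key x
      rw [hφ, LinearMap.smul_apply, smul_eq_mul] at hx
      have : (2 : Λ) * (r * φ x) = 2 * (w * g x) := by
        calc (2 : Λ) * (r * φ x) = r * (2 * φ x) := by ring
          _ = 2 * w * g x := hx
          _ = _ := by ring
      have h' := mul_left_cancel₀ h2.ne_zero this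
      calc g x = ((w⁻¹ : Λˣ) : Λ) * (w * g x) := by rw [← mul_assoc, Units.inv_mul, one_mul]
        _ = _ := by rw [← h']; ring
    by_cases hru : IsUnit r
    · exact hru.dvd
    · exfalso
      have hprod : ε (((w⁻¹ : Λˣ) : Λ) * r) * ε (φ m₀) = 2 * u₀ := by
        rw [← map_mul, ← hwit, hg m₀]
      rcases hirr'.isUnit_or_isUnit hprod.symm with h1 | h1
      · have : IsUnit (((w⁻¹ : Λˣ) : Λ) * r) := IsLocalHom.map_nonunit _ h1
        exact hru (isUnit_of_mul_isUnit_right this)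
      · exact εnu _ (NF φ m₀) h1

/-- Rank one + torsion-free + one functional hitting a unit ⟹ the module is cyclic on that element. -/
theorem eq_smul_of_isUnit_apply [NoZeroSMulDivisors Λ M]
    (hrk : ∀ m m' : M, ∃ a b : Λ, (a ≠ 0 ∨ b ≠ 0) ∧ a • m = b • m')
    (φ : M →ₗ[Λ] Λ) (m₀ : M) (hu : IsUnit (φ m₀)) (m : M) : ∃ a : Λ, m = a • m₀ := by
  obtain ⟨v, hv⟩ := hu
  set c : Λ := φ m * ((v⁻¹ : Λˣ) : Λ) with hc
  refine ⟨c, ?_⟩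
  set k : M := m - c • m₀ with hk
  have hφk : φ k = 0 := by
    simp only [hk, map_sub, map_smul, smul_eq_mul, hc, ← hv]
    rw [mul_assoc, Units.inv_mul, mul_one, sub_self]
  obtain ⟨a, b, hab, habk⟩ := hrk k m₀
  have hb : b = 0 := by
    have := congrArg φ habk
    rw [map_smul, map_smul, hφk, smul_zero, smul_eq_mul, ← hv] at this
    have : b * (v : Λ) * ((v⁻¹ : Λˣ) : Λ) = 0 := by rw [← this]; ring
    simpa [mul_assoc, Units.mul_inv] using this
  have ha : a ≠ 0 := by
    rcases hab with ha | hb' <;> [exact ha; exact absurd hb hb']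
  have hk0 : k = 0 := by
    rw [hb, zero_smul] at habk
    exact (eq_zero_or_eq_zero_of_smul_eq_zero habk).resolve_left ha
  exact sub_eq_zero.mp (hk ▸ hk0)

/-- NON-FREENESS FROM LAYER 0 (conductor 4).  `q : M → U` the layer-0 map (semilinear along
`ε : Λ →+* O`, `O = Λ/(T) = ℤ₂`), rank one, torsion-free.  If the image of `q` contains a non-zero
element `t` killed by `2` (`t = −1 ∈ D₀ ⊆ Im q`: census + lower sandwich half) and a torsion-free
element `y`, then NO functional `M → Λ` hits a unit (`M` is not free).  No `K3_EXACT`, no count. -/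
theorem not_isUnit_apply_of_image [NoZeroSMulDivisors Λ M] {O : Type*} [CommRing O]
    [NoZeroDivisors O] (h2O : (2 : O) ≠ 0) (ε : Λ →+* O) {U : Type*} [AddCommGroup U] [Module O U]
    (q : M →ₛₗ[ε] U) (hrk : ∀ m m' : M, ∃ a b : Λ, (a ≠ 0 ∨ b ≠ 0) ∧ a • m = b • m')
    (t : U) (ht : t ∈ Set.range q) (ht0 : t ≠ 0) (h2t : (2 : O) • t = 0)
    (y : U) (hy : y ∈ Set.range q) (hyt : ∀ s : O, s • y = 0 → s = 0)
    (φ : M →ₗ[Λ] Λ) (m₀ : M) : ¬ IsUnit (φ m₀) := by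
  intro hu
  obtain ⟨mt, rfl⟩ := ht
  obtain ⟨my, rfl⟩ := hy
  obtain ⟨a, ha⟩ := eq_smul_of_isUnit_apply hrk φ m₀ hu mt
  obtain ⟨b, hb⟩ := eq_smul_of_isUnit_apply hrk φ m₀ hu my
  have hqt : q mt = ε a • q m₀ := by rw [ha, LinearMap.map_smulₛₗ]
  have hqy : q my = ε b • q m₀ := by rw [hb, LinearMap.map_smulₛₗ]
  have h1 : (2 * ε a) • q my = 0 := by
    rw [hqy, smul_smul, mul_comm (2 * ε a) (ε b), ← smul_smul, ← smul_smul, ← hqt, h2t, smul_zero]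
  have h2a : 2 * ε a = 0 := hyt _ h1
  have hεa : ε a = 0 := by
    rcases mul_eq_zero.mp h2a with h | h
    · exact absurd h h2O
    · exact h
  apply ht0
  rw [hqt, hεa, zero_smul]

/-- THE LAYER-0 PACKAGE, CONDUCTOR 8 (`u ∈ {±2, ±6}`): inputs = the normalisation `L = (2w) • g`
(R206), layer-0 naturality `ε ∘ g = g₀ ∘ q`, and ONE element `x ∈ Im q` (the principal quotient
`(1+√u)/(1−√u) ∈ D₀ ⊆ U₀`) whose `g₀ = log₂/(2√u)`-value is a UNIT of `ℤ₂`. -/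
theorem layerZero_condEight {O : Type*} [CommRing O] (ε : Λ →+* O) [IsLocalHom ε]
    (g L : M →ₗ[Λ] Λ) (w : Λˣ) (hL : L = ((2 : Λ) * w) • g)
    {U : Type*} [AddCommGroup U] [Module O U] (q : M →ₛₗ[ε] U) (g₀ : U →ₗ[O] O)
    (hnat : ∀ m, ε (g m) = g₀ (q m)) (x : U) (hx : x ∈ Set.range q) (hwit : IsUnit (g₀ x)) :
    LowerDigit L := by
  obtain ⟨m₀, rfl⟩ := hx
  exact lowerDigit_of_isUnit_apply g L w hL m₀
    (isUnit_apply_of_isUnit_map ε g m₀ (by rw [hnat]; exact hwit))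

/-- THE LAYER-0 PACKAGE, CONDUCTOR 4 (`u ∈ {−1, 3}`): inputs = `L = (2w) • g` (R206), layer-0
naturality, rank one (torsion-free), ONE element `x ∈ Im q` with `g₀ x = 2·unit` (the principal
quotient of `1 + 2√u`), and the census element `t = −1 ∈ D₀ ⊆ Im q` (`t ≠ 0`, `2t = 0`).  The ring
facts (`2` prime in `Λ_v = ℤ₂⟦T⟧`, `2` irreducible in `ℤ₂`, `ε = ev₀` local) are discharged below. -/
theorem layerZero_condFour [IsDomain Λ] [NoZeroSMulDivisors Λ M] (h2 : Prime (2 : Λ))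
    {O : Type*} [CommRing O] [NoZeroDivisors O] (hirr : Irreducible (2 : O)) (ε : Λ →+* O)
    [IsLocalHom ε] (g L : M →ₗ[Λ] Λ) (w : Λˣ) (hL : L = ((2 : Λ) * w) • g)
    (hrk : ∀ m m' : M, ∃ a b : Λ, (a ≠ 0 ∨ b ≠ 0) ∧ a • m = b • m')
    {U : Type*} [AddCommGroup U] [Module O U] (q : M →ₛₗ[ε] U) (g₀ : U →ₗ[O] O)
    (hnat : ∀ m, ε (g m) = g₀ (q m)) (x : U) (hx : x ∈ Set.range q) (u₀ : Oˣ)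
    (hwit : g₀ x = 2 * u₀) (t : U) (ht : t ∈ Set.range q) (ht0 : t ≠ 0) (h2t : (2 : O) • t = 0) :
    LowerDigit L := by
  have h2O : (2 : O) ≠ 0 := hirr.ne_zero
  -- the witness is a torsion-free element of the image (its `g₀`-value is `2·unit ≠ 0`)
  have hyt : ∀ s : O, s • x = 0 → s = 0 := fun s hs => by
    have : s * (2 * u₀) = 0 := by rw [← hwit, ← smul_eq_mul, ← map_smul, hs, map_zero]
    rcases mul_eq_zero.mp this with h | h
    · exact h
    · exact absurd h ((irreducible_mul_isUnit u₀.isUnit).mpr hirr).ne_zero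
  have NF : ∀ (φ : M →ₗ[Λ] Λ) (m : M), ¬ IsUnit (φ m) :=
    not_isUnit_apply_of_image h2O ε q hrk t ht ht0 h2t x hx hyt
  obtain ⟨m₀, rfl⟩ := hx
  exact lowerDigit_of_nonfree h2 hirr ε g L w hL NF m₀ u₀ (by rw [hnat]; exact hwit)

/-- PLAN B (receptacle, B46 for LOWER): `LowerDigit` transports along ANY comparison map
`θ : R → M` through which functionals on `R` extend (`hext`) and are determined (`hdet`) — no
isomorphism `R ≅ lim S_m`, no idempotents. -/
theorem LowerDigit.comp_of_extend {R : Type*} [AddCommGroup R] [Module Λ R] (θ : R →ₗ[Λ] M)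
    {L : M →ₗ[Λ] Λ} (hL : LowerDigit L)
    (hext : ∀ h' : R →ₗ[Λ] Λ, ∃ h : M →ₗ[Λ] Λ, h' = h ∘ₗ θ)
    (hdet : ∀ f₁ f₂ : M →ₗ[Λ] Λ, f₁ ∘ₗ θ = f₂ ∘ₗ θ → f₁ = f₂) : LowerDigit (L ∘ₗ θ) := by
  intro h' r hr
  obtain ⟨h, rfl⟩ := hext h'
  refine hL h r (hdet _ _ ?_)
  rw [hr, LinearMap.smul_comp]

/-- `hdet` from ONE non-zero-divisor `a` with `a • M ⊆ Im θ` (finite colength gives `a = 2^k`). -/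
theorem det_of_smul_mem_range [IsDomain Λ] {R : Type*} [AddCommGroup R] [Module Λ R]
    (θ : R →ₗ[Λ] M) (a : Λ) (ha : a ≠ 0) (hsm : ∀ m : M, a • m ∈ LinearMap.range θ)
    (f₁ f₂ : M →ₗ[Λ] Λ) (h : f₁ ∘ₗ θ = f₂ ∘ₗ θ) : f₁ = f₂ := by
  ext m
  obtain ⟨r, hr⟩ := hsm m
  apply mul_left_cancel₀ ha
  have h1 : f₁ (θ r) = f₂ (θ r) := by
    simpa using congrArg (fun F : R →ₗ[Λ] Λ => F r) h
  rw [← smul_eq_mul, ← smul_eq_mul, ← map_smul, ← map_smul, ← hr, h1]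

end Abstract

section Carriers

/-! ### Instantiation facts for the carriers of record: `Λ_v = ℤ₂⟦T⟧`, `ε = ev₀ = constantCoeff`. -/

/-- `ev₀ : R⟦X⟧ → R` (constant coefficient) is a local hom: layer 0 detects units. -/
theorem isLocalHom_constantCoeff (R : Type*) [CommRing R] :
    IsLocalHom (PowerSeries.constantCoeff (R := R)) :=
  ⟨fun _ h => PowerSeries.isUnit_iff_constantCoeff.mpr h⟩

/-- A constant `C p` with `R/(p)` a domain is prime in `R⟦X⟧` (kernel of the reduction map). -/
theorem prime_C_of_span_isPrime {R : Type*} [CommRing R] {p : R} (hp : (Ideal.span {p}).IsPrime)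
    (hp0 : p ≠ 0) : Prime (PowerSeries.C p : PowerSeries R) := by
  classical
  have hC0 : (PowerSeries.C p : PowerSeries R) ≠ 0 := by
    intro h
    apply hp0
    have := congrArg (PowerSeries.constantCoeff (R := R)) h
    simpa using this
  rw [← Ideal.span_singleton_prime hC0]
  haveI : IsDomain (R ⧸ Ideal.span {p}) := (Ideal.Quotient.isDomain_iff_prime _).mpr hp
  let π : PowerSeries R →+* PowerSeries (R ⧸ Ideal.span {p}) :=
    PowerSeries.map (Ideal.Quotient.mk (Ideal.span {p}))
  suffices hker : Ideal.span {PowerSeries.C p} = RingHom.ker π by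
    rw [hker]; exact RingHom.ker_isPrime π
  apply le_antisymm
  · rw [Ideal.span_le, Set.singleton_subset_iff, SetLike.mem_coe, RingHom.mem_ker]
    ext n
    simp [π]
  · intro f hf
    rw [RingHom.mem_ker] at hf
    have hcoef : ∀ n, p ∣ PowerSeries.coeff n f := fun n => by
      have := congrArg (PowerSeries.coeff n) hf
      rw [PowerSeries.coeff_map, map_zero, Ideal.Quotient.eq_zero_iff_mem,
        Ideal.mem_span_singleton] at this
      exact this
    choose c hc using hcoef
    rw [Ideal.mem_span_singleton]
    refine ⟨PowerSeries.mk c, ?_⟩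
    ext n
    rw [PowerSeries.coeff_C_mul, PowerSeries.coeff_mk, hc n]

/-- `2` is prime in `Λ_v = ℤ₂⟦T⟧` (`Λ_v/2 = 𝔽₂⟦T⟧`). -/
theorem prime_two_powerSeries : Prime (2 : PowerSeries ℤ_[2]) := by
  have h : (PowerSeries.C (2 : ℤ_[2]) : PowerSeries ℤ_[2]) = 2 := map_ofNat _ 2
  rw [← h]
  refine prime_C_of_span_isPrime ?_ two_ne_zero
  have : Ideal.span {(2 : ℤ_[2])} = IsLocalRing.maximalIdeal ℤ_[2] := by
    rw [PadicInt.maximalIdeal_eq_span_p]; norm_num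
  rw [this]
  exact Ideal.IsMaximal.isPrime inferInstance

/-- `2` is irreducible in `ℤ₂`. -/
theorem irreducible_two_padicInt : Irreducible (2 : ℤ_[2]) := by
  have := PadicInt.irreducible_p (p := 2)
  simpa using this

/-- The layer-0 evaluation `ev₀ = constantCoeff : ℤ₂⟦T⟧ →+* ℤ₂` is a local hom (units are read
at layer 0). -/
theorem isLocalHom_ev₀ : IsLocalHom (PowerSeries.constantCoeff (R := ℤ_[2])) :=
  isLocalHom_constantCoeff ℤ_[2]

/-- `𝔪_v² ↦ 4ℤ₂` under `ev₀`: a `g`-value with `ev₀ = 2·unit` lies outside `𝔪_v²` — the conductor-4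
witness read at layer 0 is an `𝔪_v ∖ 𝔪_v²` witness. -/
theorem constantCoeff_mem_span_four_of_mem_sq (f : PowerSeries ℤ_[2])
    (hf : f ∈ (IsLocalRing.maximalIdeal (PowerSeries ℤ_[2])) ^ 2) :
    (4 : ℤ_[2]) ∣ PowerSeries.constantCoeff f := by
  have hε : ∀ a ∈ IsLocalRing.maximalIdeal (PowerSeries ℤ_[2]), (2 : ℤ_[2]) ∣ PowerSeries.constantCoeff a := by
    intro a ha
    have hna : ¬ IsUnit (PowerSeries.constantCoeff a) := fun h =>
      (IsLocalRing.mem_maximalIdeal _ |>.mp ha) (PowerSeries.isUnit_iff_constantCoeff.mpr h)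
    have : PowerSeries.constantCoeff a ∈ IsLocalRing.maximalIdeal ℤ_[2] := hna
    rw [PadicInt.maximalIdeal_eq_span_p, Ideal.mem_span_singleton] at this
    simpa using this
  rw [pow_two] at hf
  refine Submodule.mul_induction_on hf ?_ ?_
  · intro a ha b hb
    obtain ⟨c, hc⟩ := hε a ha
    obtain ⟨d, hd⟩ := hε b hb
    exact ⟨c * d, by rw [map_mul, hc, hd]; ring⟩
  · intro x y hx hy
    rw [map_add]; exact dvd_add hx hy

end Carriers

section Consistency

/-! ### Consistency with the record: K35's counter-model, B53's layer-0-blind pair, B46's dichotomy. -/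

local notation "Λ₂" => PowerSeries ℤ_[2]

/-- K35's counter-model honoured: on the FREE class with `L = 2(T+2) • id` the LOWER digit FAILS
(`r = 2(T+2) ∤ 2`), consistently with `LowerDigit` needing non-freeness for conductor 4 — the free
module has the identity functional hitting `1`. -/
theorem counterModel_not_lowerDigit :
    ¬ LowerDigit ((2 * (PowerSeries.X + 2) : Λ₂) • (LinearMap.id : Λ₂ →ₗ[Λ₂] Λ₂)) := by
  intro h
  obtain ⟨c, hc⟩ := h LinearMap.id (2 * (PowerSeries.X + 2)) rfl
  have h1 : (2 : Λ₂) * 1 = 2 * ((PowerSeries.X + 2) * c) := by rw [mul_one, ← mul_assoc]; exact hc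
  have h2 := mul_left_cancel₀ prime_two_powerSeries.ne_zero h1
  have hu : IsUnit (PowerSeries.X + 2 : Λ₂) := IsUnit.of_mul_eq_one _ h2.symm
  rw [PowerSeries.isUnit_iff_constantCoeff] at hu
  simp at hu
  have h22 : IsUnit (2 : ℤ_[2]) := hu
  exact irreducible_two_padicInt.not_isUnit h22

/-- Every functional on an ideal `I ∋ 2` containing an element NOT divisible by `2` is a scalar
multiple of the inclusion (`Hom(I, Λ) = Λ · incl`; covers `⊤`, `𝔪 = (2,T)`, `𝔟' = (2,T²)`, `(2,T^k)`). -/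
theorem functional_eq_smul_subtype {Λ : Type*} [CommRing Λ] [IsDomain Λ] (h2 : Prime (2 : Λ))
    (I : Ideal Λ) (h2I : (2 : Λ) ∈ I) (z : Λ) (hz : z ∈ I) (hnz : ¬ (2 : Λ) ∣ z)
    (h : I →ₗ[Λ] Λ) : ∃ c : Λ, h = c • I.subtype := by
  have hz2 : z * h ⟨2, h2I⟩ = 2 * h ⟨z, hz⟩ := by
    rw [← smul_eq_mul, ← smul_eq_mul, ← map_smul, ← map_smul]
    congr 1
    ext; simp [mul_comm]
  have hdvd : (2 : Λ) ∣ h ⟨2, h2I⟩ := by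
    have : (2 : Λ) ∣ z * h ⟨2, h2I⟩ := ⟨_, hz2⟩
    rcases h2.dvd_or_dvd this with h1 | h1
    · exact absurd h1 hnz
    · exact h1
  obtain ⟨c, hc⟩ := hdvd
  refine ⟨c, ?_⟩
  ext ⟨i, hi⟩
  apply mul_left_cancel₀ h2.ne_zero
  have : (2 : Λ) * h ⟨i, hi⟩ = i * h ⟨2, h2I⟩ := by
    rw [← smul_eq_mul, ← smul_eq_mul, ← map_smul, ← map_smul]
    congr 1
    ext; simp [mul_comm]
  rw [this, hc, LinearMap.smul_apply, Submodule.subtype_apply, smul_eq_mul]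
  ring

/-- B53-compatibility: for EVERY class in the layer-0-indistinguishable family and for the free
class, `L = (2w) • incl` has the LOWER digit — LOWER never separates `𝔪_v` from `(2,T²)`. -/
theorem lowerDigit_smul_subtype {Λ : Type*} [CommRing Λ] [IsDomain Λ] (h2 : Prime (2 : Λ))
    (I : Ideal Λ) (h2I : (2 : Λ) ∈ I) (z : Λ) (hz : z ∈ I) (hnz : ¬ (2 : Λ) ∣ z) (w : Λˣ) :
    LowerDigit (((2 : Λ) * w) • I.subtype) := by
  intro h r hr
  obtain ⟨c, rfl⟩ := functional_eq_smul_subtype h2 I h2I z hz hnz h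
  have := congrArg (fun F : I →ₗ[Λ] Λ => F ⟨2, h2I⟩) hr
  simp only [LinearMap.smul_apply, Submodule.subtype_apply, smul_eq_mul] at this
  -- `2 * w * 2 = r * (c * 2)`
  have h' : (2 : Λ) * (w * 2) = 2 * (r * c) := by
    calc (2 : Λ) * (w * 2) = 2 * w * 2 := by ring
      _ = r * (c * 2) := this
      _ = 2 * (r * c) := by ring
  have h'' := mul_left_cancel₀ h2.ne_zero h'
  exact ⟨c * ((w⁻¹ : Λˣ) : Λ), by
    calc (2 : Λ) = w * 2 * ((w⁻¹ : Λˣ) : Λ) := by rw [mul_comm (w : Λ) 2, mul_assoc, Units.mul_inv, mul_one]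
      _ = r * (c * ((w⁻¹ : Λˣ) : Λ)) := by rw [h'']; ring⟩

/-- The maximal ideal `𝔪_v = (2, T)` instance: `T ∈ 𝔪_v`, `2 ∤ T`. -/
theorem lowerDigit_maximalIdeal_class (w : (Λ₂)ˣ) :
    LowerDigit (((2 : Λ₂) * w) • (IsLocalRing.maximalIdeal Λ₂).subtype) := by
  refine lowerDigit_smul_subtype prime_two_powerSeries _ ?_ PowerSeries.X ?_ ?_ w
  · -- `2 ∈ 𝔪_v`
    have : ¬ IsUnit (2 : Λ₂) := prime_two_powerSeries.not_unit
    exact this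
  · -- `T ∈ 𝔪_v`
    have : ¬ IsUnit (PowerSeries.X : Λ₂) := PowerSeries.X_prime.not_unit
    exact this
  · -- `2 ∤ T`
    rintro ⟨c, hc⟩
    have := congrArg (PowerSeries.coeff 1) hc
    rw [PowerSeries.coeff_one_X, show (2 : Λ₂) = PowerSeries.C 2 from (map_ofNat _ 2).symm,
      PowerSeries.coeff_C_mul] at this
    have h2u : IsUnit (2 : ℤ_[2]) := IsUnit.of_mul_eq_one _ this.symm
    exact irreducible_two_padicInt.not_isUnit h2u

/-- B53's witness class `𝔟' = (2, T²)`: the same LOWER digit. -/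
theorem lowerDigit_bPrime_class (w : (Λ₂)ˣ) :
    LowerDigit (((2 : Λ₂) * w) • (Ideal.span {(2 : Λ₂), PowerSeries.X ^ 2}).subtype) := by
  refine lowerDigit_smul_subtype prime_two_powerSeries _ (Ideal.subset_span (by simp))
    (PowerSeries.X ^ 2) (Ideal.subset_span (by simp)) ?_ w
  rintro ⟨c, hc⟩
  have := congrArg (PowerSeries.coeff 2) hc
  rw [PowerSeries.coeff_X_pow_self, show (2 : Λ₂) = PowerSeries.C 2 from (map_ofNat _ 2).symm,
    PowerSeries.coeff_C_mul] at this
  have h2u : IsUnit (2 : ℤ_[2]) := IsUnit.of_mul_eq_one _ this.symm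
  exact irreducible_two_padicInt.not_isUnit h2u

/-- B46 DICHOTOMY, positive branch: an index-2 SUB-receptacle (`𝔪_v ↪ Λ_v`) keeps the digit of
`L = 2 • id` (this is `lowerDigit_maximalIdeal_class` with `w = 1`, read as `L ∘ incl`). -/
theorem digit_kept_along_index_two :
    LowerDigit (((2 : Λ₂) • (LinearMap.id : Λ₂ →ₗ[Λ₂] Λ₂)) ∘ₗ (IsLocalRing.maximalIdeal Λ₂).subtype) := by
  have h := lowerDigit_maximalIdeal_class 1
  simp only [Units.val_one, mul_one] at h
  have e : ((2 : Λ₂) • (LinearMap.id : Λ₂ →ₗ[Λ₂] Λ₂)) ∘ₗ (IsLocalRing.maximalIdeal Λ₂).subtype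
      = (2 : Λ₂) • (IsLocalRing.maximalIdeal Λ₂).subtype := by
    ext; simp
  rw [e]; exact h

/-- B46 DICHOTOMY, negative branch: along the «multiplication by 2» comparison (the invariants-type
χ-part `(1+δ)N ≅ Λ` mapping onto `2Λ` inside the coinvariants-type χ-part `N/(δ−1)N ≅ Λ` when
`#Δ = 2`) the digit of `L = 2 • id` is LOST: `L ∘ θ = 4 • id`, `4 ∤ 2`. -/
theorem digit_lost_along_mul_two :
    ¬ LowerDigit (((2 : Λ₂) • (LinearMap.id : Λ₂ →ₗ[Λ₂] Λ₂)) ∘ₗ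
        ((2 : Λ₂) • (LinearMap.id : Λ₂ →ₗ[Λ₂] Λ₂))) := by
  intro h
  have hfac : ((2 : Λ₂) • (LinearMap.id : Λ₂ →ₗ[Λ₂] Λ₂)) ∘ₗ ((2 : Λ₂) • (LinearMap.id : Λ₂ →ₗ[Λ₂] Λ₂))
      = (4 : Λ₂) • (LinearMap.id : Λ₂ →ₗ[Λ₂] Λ₂) := by
    ext; simp [smul_eq_mul]; norm_num
  obtain ⟨c, hc⟩ := h LinearMap.id 4 hfac
  -- `2 = 4c` in `ℤ₂⟦T⟧` ⟹ `1 = 2c` ⟹ `2` a unit: contradiction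
  have h1 : (2 : Λ₂) * 1 = 2 * (2 * c) := by rw [mul_one, ← mul_assoc]; norm_num; exact hc
  have h2 := mul_left_cancel₀ prime_two_powerSeries.ne_zero h1
  have hu : IsUnit (2 : Λ₂) := IsUnit.of_mul_eq_one _ h2.symm
  exact prime_two_powerSeries.not_unit hu

end Consistency

end Summit.BirchSwinnertonDyer.BirchSwinnertonDyer.Cruxes.SplitBadTwoLowerHalfOfFacts.LayerZeroLowerK1G33
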